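import Summits.QuantumFields.YangMills.Theorems.HyperbolicRegulatorHyperbolicToTorusRDefs
import Summits.QuantumFields.YangMills.Theorems.HyperbolicRegulatorHyperbolicToTorusRPairProduct
import Literature.MathematicalPhysics.QuantumLattice.LatticeGaugeDLRGibbsProofs
import Literature.Probability.LatticeModels.GibbsSpecification
import HarnessLib

/-!
# Replica decoupling (stub `stub_replicaDecoupling` of line `replica-rooting`, crux `HyperbolicToTorusR`)

Stub (RT) of crux `Summit.QuantumFields.YangMills.Theses.HyperbolicRegulator.HyperbolicToTorusR`
(stmt-QuantumFields-18156), registered skeleton `Cruxes/HyperbolicToTorusR/Lines/replica_rooting.lean`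
(sha `79b7961b…`), vocabulary `Theorems/HyperbolicRegulatorHyperbolicToTorusRDefs.lean` (`IsRootedPairState`, `shiftObs`,
`prodObs`).  The SOFT decoupling step: if at `β` all translation-invariant DLR states of Wilson's `ℤ⁴` specification
`γ = ymSpecification r.ρ β` agree on species (U_tr) and are extremal Gibbs states (EXT), then a rooted pair state `Q` on
`Ω × Ω` (`Ω = LGConfig 4 G`) whose cross-copy second moments obey the table
`|∫ A(ω₁) τₙB(ω₁) dQ − ∫ A(ω₁) τₙB(ω₂) dQ| ≤ C e^{−mn}` forces `|cov_ν(A, τₙB)| ≤ C e^{−mn}` for EVERY translation-invariant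
DLR state `ν`.

## Proof (disintegration-free; the general lemmas are the LANDED helper `Theorems/HyperbolicRegulatorHyperbolicToTorusRPairProduct.lean`)

* `eq_smul_of_add_eq_of_isExtremalGibbs` — if an extremal Gibbs measure `μ` of a specification `γ` splits as `μ = ν₁ + ν₂`
  with both pieces satisfying the DLR identity `∫ γ_Λ(A|η) dνᵢ(η) = νᵢ(A)`, then `ν₁ = ν₁(Ω) • μ` (normalise the pieces
  when both are non-zero: `μ` lies in the open segment between two Gibbs measures; the degenerate cases are direct).
* Conditional DLR of `Q` in the second copy, tested on the rectangle `s ×ˢ t`, says that the piece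
  `ν_s := (Q|_{fst ⁻¹ s}) ∘ snd⁻¹`, `ν_s(t) = Q(s ×ˢ t)`, satisfies the DLR identity
  (`setLIntegral_fst_preimage_eq`, `piece_dlr`); with `s = Ω` the second marginal `Q₂` is a DLR state
  (`map_snd_mem_gibbsMeasures`).  If `Q₂` is extremal, `ν_s = Q₁(s) • Q₂`, i.e. `Q(s ×ˢ t) = Q₁(s) Q₂(t)`
  (`measure_prod_eq_mul_of_isExtremalGibbs`), so `Q = Q₁ ⊗ Q₂` (`prod_map_eq_of_isExtremalGibbs`, Mathlib `Measure.prod_eq`).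
* For a rooted pair state, swap symmetry gives `Q₁ = Q₂`, which is DLR and translation invariant, hence extremal by EXT;
  so `Q = Q₁ ⊗ Q₁`, the table reads `|∫ A τₙB dQ₁ − (∫ A dQ₁)(∫ τₙB dQ₁)| ≤ C e^{−mn}` (`integral_prod_mul`, `integral_map`),
  and U_tr applied to the species `A`, `shiftObs B (−n e₀)`, `prodObs A (shiftObs B (−n e₀))` moves the three integrals to
  any translation-invariant DLR `ν`.

Georgii 2011 Ch. 7 (extremal Gibbs measures, Thm. 7.7) and Friedli–Velenik 2017 §6.8 for the notions; the argument is
elementary measure theory.  No named fact is consumed; nothing is asserted about the route beyond the registered stub.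
-/

noncomputable section

open scoped BigOperators Topology Classical MeasureTheory ProbabilityTheory Matrix ENNReal
open Filter Set Function TopologicalSpace MeasureTheory
open Literature.MathematicalPhysics.QuantumFieldTheory (LatticeRep YMSpecies IsCompactSimpleLieGroup)
open Literature.Probability.LatticeModels (Site IsExtremalGibbs Specification IsGibbsMeasure gibbsMeasures)
open Literature.MathematicalPhysics.QuantumLattice (LGConfig ZdEdge configShift IsZdTranslationInvariant
  LocalGaugeObservable ymSpecification ymGibbsMeasures measurable_ymSpecification_apply)
open Summit.QuantumFields.YangMills.Cruxes.HyperbolicToTorusR.ReplicaRooting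

namespace Summit.QuantumFields.YangMills.Theorems.HyperbolicToTorusR

/-! ## The registered stub -/

/-- **Stub (RT) `stub_replicaDecoupling` of line `replica-rooting`** (registered signature, verbatim): at `β`, agreement
of translation-invariant DLR states on species (U_tr) and their extremality (EXT), together with a rooted pair state whose
cross-copy second moments for `(A, B)` obey the table with constant `C` at rate `m`, give
`|cov_ν(A, τₙB)| ≤ C e^{−mn}` for every translation-invariant DLR state `ν` and every `n`.  Soft: the rooted pair state
is the product `Q₁ ⊗ Q₁` of its (extremal) marginal (`prod_map_eq_of_isExtremalGibbs`), so the table is the covariance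
bound for `Q₁`, and U_tr moves it to `ν`. [folklore] -/
theorem stub_replicaDecoupling :
    ∀ (G : Type) [Group G] [TopologicalSpace G] [IsTopologicalGroup G] [CompactSpace G]
      [MeasurableSpace G] [BorelSpace G], IsCompactSimpleLieGroup G → ∀ (r : LatticeRep G) (β m : ℝ)
      (A B : YMSpecies G) (C : ℝ),
      (∀ μ ν : MeasureTheory.Measure (LGConfig 4 G), μ ∈ ymGibbsMeasures r.ρ β →
        ν ∈ ymGibbsMeasures r.ρ β → IsZdTranslationInvariant μ → IsZdTranslationInvariant ν →
          ∀ X : YMSpecies G, ∫ U, X.F U ∂μ = ∫ U, X.F U ∂ν) →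
      (∀ μ : MeasureTheory.Measure (LGConfig 4 G), μ ∈ ymGibbsMeasures r.ρ β →
        IsZdTranslationInvariant μ → IsExtremalGibbs (ymSpecification r.ρ β) μ) →
      (∃ Q : Measure (LGConfig 4 G × LGConfig 4 G), IsRootedPairState r β Q ∧ ∀ n : ℕ,
        |(∫ p, A.F p.1 * B.F (configShift (-Pi.single 0 (n : ℤ)) p.1) ∂Q) -
            ∫ p, A.F p.1 * B.F (configShift (-Pi.single 0 (n : ℤ)) p.2) ∂Q| ≤ C * Real.exp (-(m * n))) →
      ∀ ν : MeasureTheory.Measure (LGConfig 4 G), ν ∈ ymGibbsMeasures r.ρ β → IsZdTranslationInvariant ν →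
        ∀ n : ℕ, |(∫ U, A.F U * B.F (configShift (-Pi.single 0 (n : ℤ)) U) ∂ν) -
            (∫ U, A.F U ∂ν) * (∫ U, B.F (configShift (-Pi.single 0 (n : ℤ)) U) ∂ν)| ≤ C * Real.exp (-(m * n)) := by
  intro G _ _ _ _ _ _ _hG r β m A B C hU hE hQ ν hν hνT n
  -- `G` is second countable: `r.ρ` is a closed embedding into a matrix space
  haveI : SecondCountableTopology G :=
    (r.continuous.isClosedEmbedding r.injective).isEmbedding.secondCountableTopology
  obtain ⟨Q, ⟨hP, hswap, hDLR, hT⟩, htab⟩ := hQ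
  haveI := hP
  have hγm : ∀ (Λ : Finset (ZdEdge 4)) (t : Set (LGConfig 4 G)), MeasurableSet t →
      Measurable fun η => ymSpecification r.ρ β Λ η t :=
    fun Λ t ht => measurable_ymSpecification_apply r.ρ r.continuous β Λ ht
  -- swap symmetry: the two marginals coincide
  have h21 : Q.map Prod.snd = Q.map Prod.fst :=
    calc Q.map Prod.snd = (Q.map Prod.swap).map Prod.fst := by
          rw [Measure.map_map measurable_fst measurable_swap]; rfl
      _ = Q.map Prod.fst := by rw [hswap]
  -- the marginal is a translation-invariant DLR state, hence extremal (EXT), hence `Q = Q₁ ⊗ Q₁`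
  have hG1 : Q.map Prod.fst ∈ ymGibbsMeasures r.ρ β := by
    rw [← h21]; exact map_snd_mem_gibbsMeasures hγm hDLR
  have hext : IsExtremalGibbs (ymSpecification r.ρ β) (Q.map Prod.snd) := by
    rw [h21]; exact hE _ hG1 hT
  have hprod : (Q.map Prod.fst).prod (Q.map Prod.fst) = Q := by
    have h := prod_map_eq_of_isExtremalGibbs hγm hDLR hext
    rwa [h21] at h
  haveI : IsProbabilityMeasure (Q.map Prod.fst) :=
    Measure.isProbabilityMeasure_map measurable_fst.aemeasurable
  -- the table, read on the marginal
  have hmeasAB : Measurable fun U : LGConfig 4 G => A.F U * B.F (configShift (-Pi.single 0 (n : ℤ)) U) :=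
    A.measurable.mul (B.measurable.comp (configShift _).measurable)
  have e1 : ∫ U, A.F U * B.F (configShift (-Pi.single 0 (n : ℤ)) U) ∂(Q.map Prod.fst) =
      ∫ p, A.F p.1 * B.F (configShift (-Pi.single 0 (n : ℤ)) p.1) ∂Q :=
    integral_map measurable_fst.aemeasurable hmeasAB.aestronglyMeasurable
  have e2 : ∫ p, A.F p.1 * B.F (configShift (-Pi.single 0 (n : ℤ)) p.2) ∂Q =
      (∫ U, A.F U ∂(Q.map Prod.fst)) * ∫ U, B.F (configShift (-Pi.single 0 (n : ℤ)) U) ∂(Q.map Prod.fst) := by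
    rw [← integral_prod_mul (fun U => A.F U) (fun U => B.F (configShift (-Pi.single 0 (n : ℤ)) U)), hprod]
  -- (U_tr) on the three species `A`, `τₙB`, `A · τₙB`
  have t1 : ∫ U, A.F U ∂(Q.map Prod.fst) = ∫ U, A.F U ∂ν := hU _ ν hG1 hν hT hνT A
  have t2 := hU _ ν hG1 hν hT hνT (shiftObs B (-Pi.single 0 (n : ℤ)))
  have t3 := hU _ ν hG1 hν hT hνT (prodObs A (shiftObs B (-Pi.single 0 (n : ℤ))))
  simp only [shiftObs_F, prodObs_F] at t2 t3
  rw [← t1, ← t2, ← t3, e1, ← e2]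
  exact htab n

end Summit.QuantumFields.YangMills.Theorems.HyperbolicToTorusR

end
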